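import Summits.QuantumFields.YangMills.Theorems.DirichletWindowLocalGaussianity
import HarnessLib

/-!
# `DirichletWindow.PlaquetteVarianceOfSparsity` (item stmt-QuantumFields-20227)

Route `DirichletWindow` of `QuantumFields/YangMills`, support item
`Summit.QuantumFields.YangMills.Theses.DirichletWindow.PlaquetteVarianceOfSparsity :=
LargeFieldSparsityAllTori → PlaquetteVarianceUpper` — the variance half of the glue of the
large-field-sparsity support line for node `PlaquetteVarianceUpper` (8939).

Proof: the consequent `PlaquetteVarianceUpper` (`f_β(0) = Var_μ(Re tr r(U_p)) ≤ B/β²` for `β ≥ β₁`, uniformly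
over infinite-volume torus-limit states, every compact simple `G`) is by now a tree theorem,
`plaquetteVarianceUpper_proof` (item 8939, closed 2026-08-28 by line «exp-moment tangent law»: chessboard
exponential moments on even AND odd tori ⊕ free-energy constant term ⊕ tangent law), so the implication holds
with the antecedent unused.  HONEST LABEL: this closes the glue item AS FILED; it does not derive the variance
bound from the sparsity hypothesis (that derivation — `Var E ≤ E[E²] ≤ 8 e^{C}/β²` from `E_μ e^{βE/2} ≤ e^{C}` —
is the informal content of the item and remains a valid, now redundant, alternative).  The sparsity line
(items 20162/20194/20195/20209) is thereby no longer load-bearing for node 8939.  RECORD currency of a summit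
route; no mass gap, no continuum limit, the Yang–Mills problem is NOT advanced by this file.
-/

set_option autoImplicit false

namespace Summit.QuantumFields.YangMills.Theorems

/-- **`PlaquetteVarianceOfSparsity` holds** (item stmt-QuantumFields-20227):
`LargeFieldSparsityAllTori → PlaquetteVarianceUpper`, because the consequent is the tree theorem
`plaquetteVarianceUpper_proof` (item 8939); the antecedent is not used. -/
theorem plaquetteVarianceOfSparsity_proof :
    Summit.QuantumFields.YangMills.Theses.DirichletWindow.PlaquetteVarianceOfSparsity :=
  fun _ => plaquetteVarianceUpper_proof

end Summit.QuantumFields.YangMills.Theorems
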